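import Mathlib.Analysis.InnerProductSpace.Basic

/-!
# `Balaban1983to89.B9Eq387IMSAssembly` — T. Bałaban, *Propagators for lattice gauge theories in a background field*, Commun. Math. Phys. **99**
# (1985) 389–434 [Balaban1985BackgroundPropagators] p. 408 «Σ_□ h²_□ = 1», (3.87)–(3.89) p. 409, (3.26) p. 395 with p. 414 «DRD* = DD* − DPD*»:
# **THE IMS ASSEMBLY — LOCAL (STRONG) COERCIVITY OF `q(x) = Σ_i ‖T_i x‖² − ‖W x‖²` ON THE LOCALISED VECTORS `χ_j x` + THE DISPLAYED IMS INEQUALITIES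
# (one per letter) + OPERATOR LETTERS ⟹ GLOBAL (STRONG) COERCIVITY OF `q`, WITH THE CONSTANT WRITTEN OUT:
# `γ₁·Σ_i ‖T_i x‖² + (γ₀ − C_W k_W − (1 − γ₁)·Σ_i (t_i k_i + a_i))·‖x‖² ≤ Σ_i ‖T_i x‖² − ‖W x‖²`** — route R2′ STEP B8′ of the pub-balaban NE9 chain,
# S-P7 «assembly + constants» as ONE norm-only theorem

statement-level skeleton of published theorems with citation tags; proofs where landed; nothing here is a claim about the Yang–Mills mass gap

CITATION HEADER (lean-in-tree rule).  Audit cell `pub-balaban`, sub-cell `t4`, BINDER row NE9; filed by NE9 formalisation-swarm LEAF PROVER 01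
(`b2b-balaban-t4-ne9-formalise-leaf-01`, gen 80) as the PORT of the NE9 crux-ideation seat's abstract KERNEL 7 `t4/ideate/NE9/lens1-NE9IMSAssembly.lean`
v1 (t4-ne9-idea-1 gen 92, sha16 a1e00b56d6d88c8a; scratch, never proposed — CREDIT: both statements and both proofs are the kernel's, VERBATIM up to
the namespace and this header; OFFER O-idea1-g92-1, journal l.48336, first refusal this lineage as the porter of the glue files the kernel consumes by
name).  Companion files (this lineage, same step): `B9Eq387QuadraticPartitionIMS` (the displayed IMS shapes (dn)∕(up) below ARE its
`sum_localised_le_norm_sq_add` ∕ `norm_sq_le_sum_localised_add`), `B9Eq3101DoubleCommutatorBlockSchur` (the letters `k_W` = `norm_sum_adad_le`, `a_i` =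
`family_block_schur_sq`), `B9Eq3101CommutatorCauchyBlockDecay` (the commutator sizes).  Source READ in the held text (`paper:balaban1985-cmp99-background-propagators`,
journal page = PDF page + 388): p. 395 (3.26), p. 408, p. 409 (3.87)–(3.89), p. 414.

THE PRINT (verbatim).  p. 395, (3.26): *«Δ_a(U) = Δ(U) + D_U R(U) D*_U + Q*(U)aQ(U), or simply Δ_a = Δ + DRD* + Q*aQ.»*  p. 414: *«We have DRD* = DD* −
DPD*.»*  p. 408: *«We take the partition of unity {h_□} defined at the end of Sect. A in [4]. We have Σ_{□∈𝒟} h²_□ = 1.»*  p. 409, (3.87): *«G′₀ =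
Σ_{□∈𝒟} h_□G′_□h_□, C₀ = Σ_{□∈𝒟} h_□C_□h_□, G₀ = Σ_{□∈𝒟} h_□G_□h_□»*, (3.89): *«|(K(h_□)G′_□h_□λ)(x)| ≤ O(M⁻¹)e^{−δ₀d(y,y′)}|λ|»*.  Print localises
with the quadratic partition of unity through PARAMETRICES and random-walk expansions; the IMS form bookkeeping below is the ROUTE's device for the same
partition (ROUTES-NE9 §L1.2 R2′ STEP B8′ S-P7), NOT print's road; NOTHING of [B9] is asserted.

WHY (route R2′ STEP B8′, S-P7).  The bond form of `Δ_a(U)` reads `re⟪x, Δ_a(U)x⟫ = Σ_i ‖T_i x‖² − ‖W x‖²` with LOCAL first-order letters `T_i ∈ {D_U, D_U†,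
√a·Q_U}` and ONE non-local letter `W` of `DP`-type (p. 414 «DRD* = DD* − DPD*»); Tier P (B7′-1 ∕ S-P6′) gives coercivity of this form on vectors
localised in one cube; THIS theorem carries it to the torus at the price `C_W k_W + (1 − γ₁)Σ_i(t_i k_i + a_i)` — all `O(1∕M)` or `O(1∕M²)` letters at a
fixed cube size `M` — with the STRONG constant `γ₁` passing UNCHANGED.  Two located facts the statement displays: (a) the IMS cross term `‖T_i x‖·‖K_i x‖` is
consumed by the PRODUCT letter `t_i k_i` (for `T = D_U`, `t_D ∼ 2√d∕η` against `k_D ∼ η·d∕M²` the product is η-free) — no Young inequality, no loss in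
`γ₁`; (b) only `γ₀` pays.

WHAT IS PROVED (sorry-free; proof lane — no `def`; [folklore] finite sums and one multiplication of inequalities; norm-only: no inner product, no
linearity, no lattice is used).
* **`ims_assembly_strong`** — finite family of «local» letters `T_i : S → E_i` (`i : ι`, `Fintype ι`), one «non-local» letter `W : S → F`, a finite
  quadratic partition `χ_j : S → S` (`j ∈ s`) with `Σ_j ‖χ_j x‖² = ‖x‖²`, the displayed shapes (dn) `Σ_j ‖T_i(χ_j x)‖² ≤ ‖T_i x‖² + ‖T_i x‖·‖K_i x‖ +
  Σ_j ‖AD_ij x‖²`, (up) `‖W x‖² ≤ Σ_j ‖W(χ_j x)‖² + ‖W x‖·‖K_W x‖`, letters `‖T_i x‖ ≤ t_i‖x‖` (`0 ≤ t_i`), `‖K_i x‖ ≤ k_i‖x‖`, `Σ_j ‖AD_ij x‖² ≤ a_i‖x‖²`,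
  `‖W x‖ ≤ C_W‖x‖` (`0 ≤ C_W`), `‖K_W x‖ ≤ k_W‖x‖`, `γ₁ ≤ 1`, and (loc) `γ₁·Σ_i ‖T_i(χ_j x)‖² + γ₀·‖χ_j x‖² ≤ Σ_i ‖T_i(χ_j x)‖² − ‖W(χ_j x)‖²` for every
  `j ∈ s` ⟹ `γ₁·Σ_i ‖T_i x‖² + (γ₀ − C_W k_W − (1 − γ₁)·Σ_i (t_i k_i + a_i))·‖x‖² ≤ Σ_i ‖T_i x‖² − ‖W x‖²`.
* **`ims_assembly`** — the plain case `γ₁ = 0`.  §3 non-vacuity (`γ₁ = γ₀ = ½`, equality).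
DICTIONARY (words; nothing lattice is asserted): `χ_j` = multiplication by the real cube cutoffs; (dn)∕(up) = `B9Eq387QuadraticPartitionIMS` with
`K_i = Σ_j ad_j(ad_j T_i)`, `AD_ij = ad_j T_i`; `k_W‖x‖ ≥ ‖K_W x‖` from `B9Eq3101DoubleCommutatorBlockSchur.norm_sum_adad_le` (`4N√(W_rW_c)`); `a_i` from
`family_block_schur_sq` or, for `T_i = D_U`, the pointwise `Σ_j |∂χ_j|²` bound; (loc) = the cube coercivity files of the row (S-P6′ ∕ B7′-1).
HONEST SCOPE.  Norm-only bookkeeping; no estimate of any letter; S-sized glue; NOT NE9 (cell pub-balaban: NE9 NOT PRINTED ∕ NOT PROVED; «NE9 ⇐ the named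
binders»; spine PROVED 0∕9; rung (B)+1 on a finite T⁴ — NOT infinite volume, NOT mass gap, NOT Clay; HONEST DEPENDENCY: continuum YM on T⁴ ⇐ BetaPertH ∧ nine
spine estimates (0/9 proved); BetaPertH ⇐ (D1) ∧ (D4) ∧ CAP+tail; G-an2-4 gates asym, D1 and NE2/3/4).  NEW file, Mathlib-only import; nothing modified.  Net
new unproved facts: 0.
-/

namespace Literature.MathematicalPhysics.QuantumFieldTheory.Balaban1983to89.B9Eq387IMSAssembly

open scoped BigOperators

/-! ## §1 Local strong coercivity + displayed IMS shapes ⟹ global strong coercivity -/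

/-- **THE IMS ASSEMBLY, STRONG FORM**: local strong coercivity of `Σ_i‖T_i·‖² − ‖W·‖²` on the `χ_j x`, the displayed IMS shapes (dn)∕(up), and the
operator letters ⟹ `γ₁·Σ_i ‖T_i x‖² + (γ₀ − C_W k_W − (1 − γ₁)·Σ_i (t_i k_i + a_i))·‖x‖² ≤ Σ_i ‖T_i x‖² − ‖W x‖²` — `γ₁` passes unchanged, only `γ₀`
pays; the cross terms are consumed by the product letters `t_i k_i`. [folklore] (IMS localisation bookkeeping; t4-ne9-idea-1 gen 92 kernel 7, verbatim)
[cite: Balaban1985BackgroundPropagators, p.408 «Σ h²_□ = 1», (3.87)–(3.89) p.409, (3.26) p.395] -/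
theorem ims_assembly_strong
    {ι J S F : Type*} [Fintype ι] [NormedAddCommGroup S] [NormedAddCommGroup F]
    {E : ι → Type*} [∀ i, NormedAddCommGroup (E i)]
    (s : Finset J) (χ : J → S → S) (T : ∀ i, S → E i) (K : ∀ i, S → E i) (AD : ∀ i, J → S → E i) (W KW : S → F)
    {t k a : ι → ℝ} {CW kW γ₁ γ₀ : ℝ}
    (hχ : ∀ x, ∑ j ∈ s, ‖χ j x‖ ^ 2 = ‖x‖ ^ 2)
    (hdn : ∀ i x, ∑ j ∈ s, ‖T i (χ j x)‖ ^ 2 ≤ ‖T i x‖ ^ 2 + ‖T i x‖ * ‖K i x‖ + ∑ j ∈ s, ‖AD i j x‖ ^ 2)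
    (hup : ∀ x, ‖W x‖ ^ 2 ≤ ∑ j ∈ s, ‖W (χ j x)‖ ^ 2 + ‖W x‖ * ‖KW x‖)
    (hT : ∀ i x, ‖T i x‖ ≤ t i * ‖x‖) (hK : ∀ i x, ‖K i x‖ ≤ k i * ‖x‖) (ht : ∀ i, 0 ≤ t i)
    (hAD : ∀ i x, ∑ j ∈ s, ‖AD i j x‖ ^ 2 ≤ a i * ‖x‖ ^ 2)
    (hW : ∀ x, ‖W x‖ ≤ CW * ‖x‖) (hKW : ∀ x, ‖KW x‖ ≤ kW * ‖x‖) (hCW : 0 ≤ CW) (hγ₁ : γ₁ ≤ 1)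
    (hloc : ∀ j ∈ s, ∀ x, γ₁ * ∑ i, ‖T i (χ j x)‖ ^ 2 + γ₀ * ‖χ j x‖ ^ 2 ≤ ∑ i, ‖T i (χ j x)‖ ^ 2 - ‖W (χ j x)‖ ^ 2)
    (x : S) :
    γ₁ * ∑ i, ‖T i x‖ ^ 2 + (γ₀ - CW * kW - (1 - γ₁) * ∑ i, (t i * k i + a i)) * ‖x‖ ^ 2
      ≤ ∑ i, ‖T i x‖ ^ 2 - ‖W x‖ ^ 2 := by
  -- (dn) + letters, letter by letter: the cross term is consumed by the product letter `t_i k_i`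
  have h1 : ∀ i, ∑ j ∈ s, ‖T i (χ j x)‖ ^ 2 ≤ ‖T i x‖ ^ 2 + (t i * k i + a i) * ‖x‖ ^ 2 := by
    intro i
    have hx : ‖T i x‖ * ‖K i x‖ ≤ (t i * ‖x‖) * (k i * ‖x‖) :=
      mul_le_mul (hT i x) (hK i x) (norm_nonneg _) (mul_nonneg (ht i) (norm_nonneg _))
    have := hdn i x
    have := hAD i x
    nlinarith
  -- sum over the letters and exchange the two finite sums
  have hP : ∑ j ∈ s, ∑ i, ‖T i (χ j x)‖ ^ 2 ≤ ∑ i, ‖T i x‖ ^ 2 + (∑ i, (t i * k i + a i)) * ‖x‖ ^ 2 := by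
    rw [Finset.sum_comm, Finset.sum_mul, ← Finset.sum_add_distrib]
    exact Finset.sum_le_sum fun i _ => h1 i
  -- (up) + letters for the non-local letter
  have hw : ‖W x‖ ^ 2 ≤ ∑ j ∈ s, ‖W (χ j x)‖ ^ 2 + CW * kW * ‖x‖ ^ 2 := by
    have hx : ‖W x‖ * ‖KW x‖ ≤ (CW * ‖x‖) * (kW * ‖x‖) :=
      mul_le_mul (hW x) (hKW x) (norm_nonneg _) (mul_nonneg hCW (norm_nonneg _))
    have := hup x
    nlinarith
  -- (loc) summed over the cubes, with `Σ_j ‖χ_j x‖² = ‖x‖²`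
  have hl : γ₁ * ∑ j ∈ s, ∑ i, ‖T i (χ j x)‖ ^ 2 + γ₀ * ‖x‖ ^ 2
      ≤ ∑ j ∈ s, ∑ i, ‖T i (χ j x)‖ ^ 2 - ∑ j ∈ s, ‖W (χ j x)‖ ^ 2 := by
    have := Finset.sum_le_sum fun j hj => hloc j hj x
    rw [Finset.sum_add_distrib, ← Finset.mul_sum, ← Finset.mul_sum, hχ x, Finset.sum_sub_distrib] at this
    exact this
  -- assembly: one multiplication of an inequality by `1 - γ₁ ≥ 0`, then linear arithmetic
  have h5 : (1 - γ₁) * ∑ j ∈ s, ∑ i, ‖T i (χ j x)‖ ^ 2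
      ≤ (1 - γ₁) * (∑ i, ‖T i x‖ ^ 2 + (∑ i, (t i * k i + a i)) * ‖x‖ ^ 2) :=
    mul_le_mul_of_nonneg_left hP (sub_nonneg.mpr hγ₁)
  nlinarith [h5, hl, hw]

/-! ## §2 The plain case `γ₁ = 0` -/

/-- **THE IMS ASSEMBLY, PLAIN FORM** (`γ₁ = 0`): `(γ₀ − C_W k_W − Σ_i (t_i k_i + a_i))·‖x‖² ≤ Σ_i ‖T_i x‖² − ‖W x‖²`. [folklore] (IMS localisation
bookkeeping; t4-ne9-idea-1 gen 92 kernel 7, verbatim) [cite: Balaban1985BackgroundPropagators, p.408, (3.87)–(3.89) p.409, (3.26) p.395] -/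
theorem ims_assembly
    {ι J S F : Type*} [Fintype ι] [NormedAddCommGroup S] [NormedAddCommGroup F]
    {E : ι → Type*} [∀ i, NormedAddCommGroup (E i)]
    (s : Finset J) (χ : J → S → S) (T : ∀ i, S → E i) (K : ∀ i, S → E i) (AD : ∀ i, J → S → E i) (W KW : S → F)
    {t k a : ι → ℝ} {CW kW γ₀ : ℝ}
    (hχ : ∀ x, ∑ j ∈ s, ‖χ j x‖ ^ 2 = ‖x‖ ^ 2)
    (hdn : ∀ i x, ∑ j ∈ s, ‖T i (χ j x)‖ ^ 2 ≤ ‖T i x‖ ^ 2 + ‖T i x‖ * ‖K i x‖ + ∑ j ∈ s, ‖AD i j x‖ ^ 2)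
    (hup : ∀ x, ‖W x‖ ^ 2 ≤ ∑ j ∈ s, ‖W (χ j x)‖ ^ 2 + ‖W x‖ * ‖KW x‖)
    (hT : ∀ i x, ‖T i x‖ ≤ t i * ‖x‖) (hK : ∀ i x, ‖K i x‖ ≤ k i * ‖x‖) (ht : ∀ i, 0 ≤ t i)
    (hAD : ∀ i x, ∑ j ∈ s, ‖AD i j x‖ ^ 2 ≤ a i * ‖x‖ ^ 2)
    (hW : ∀ x, ‖W x‖ ≤ CW * ‖x‖) (hKW : ∀ x, ‖KW x‖ ≤ kW * ‖x‖) (hCW : 0 ≤ CW)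
    (hloc : ∀ j ∈ s, ∀ x, γ₀ * ‖χ j x‖ ^ 2 ≤ ∑ i, ‖T i (χ j x)‖ ^ 2 - ‖W (χ j x)‖ ^ 2)
    (x : S) :
    (γ₀ - CW * kW - ∑ i, (t i * k i + a i)) * ‖x‖ ^ 2 ≤ ∑ i, ‖T i x‖ ^ 2 - ‖W x‖ ^ 2 := by
  have h := ims_assembly_strong s χ T K AD W KW (γ₁ := 0) (γ₀ := γ₀) hχ hdn hup hT hK ht hAD hW hKW hCW zero_le_one
    (fun j hj y => by simpa using hloc j hj y) x
  simpa using h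

/-! ## §3 Non-vacuity: the hypotheses are jointly satisfiable with `γ₁, γ₀ > 0` and the conclusion is then sharp -/

/-- One letter `T = id` on `ℝ`, one cube `χ = id`, `W = 0`, all commutator letters `0`: every hypothesis of `ims_assembly_strong` holds with
`γ₁ = γ₀ = 1∕2`, `t = 1`, `k = a = C_W = k_W = 0`, and the conclusion reads `½‖x‖² + ½‖x‖² ≤ ‖x‖² − 0` (equality). [folklore]
[cite: Balaban1985BackgroundPropagators, p.408] -/
example (x : ℝ) :
    (1 / 2 : ℝ) * ∑ _i : Unit, ‖(fun (_ : Unit) (y : ℝ) => y) () x‖ ^ 2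
        + ((1 / 2 : ℝ) - 0 * 0 - (1 - 1 / 2) * ∑ _i : Unit, ((1 : ℝ) * 0 + 0)) * ‖x‖ ^ 2
      ≤ ∑ _i : Unit, ‖(fun (_ : Unit) (y : ℝ) => y) () x‖ ^ 2 - ‖(fun _ : ℝ => (0 : ℝ)) x‖ ^ 2 :=
  ims_assembly_strong (ι := Unit) (J := Unit) (S := ℝ) (F := ℝ) (E := fun _ => ℝ)
    (Finset.univ : Finset Unit) (fun _ y => y) (fun _ y => y) (fun _ _ => (0 : ℝ)) (fun _ _ _ => (0 : ℝ))
    (fun _ => (0 : ℝ)) (fun _ => (0 : ℝ))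
    (t := fun _ => 1) (k := fun _ => 0) (a := fun _ => 0) (CW := 0) (kW := 0) (γ₁ := 1 / 2) (γ₀ := 1 / 2)
    (by intro y; simp) (by intro i y; simp) (by intro y; simp) (by intro i y; simp) (by intro i y; simp)
    (by intro i; norm_num) (by intro i y; simp) (by intro y; simp) (by intro y; simp) le_rfl (by norm_num)
    (by intro j _ y; simp; ring_nf; exact le_rfl) x

end Literature.MathematicalPhysics.QuantumFieldTheory.Balaban1983to89.B9Eq387IMSAssembly
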